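import Summits.QuantumFields.BalabanUV.T4Continuum.Support.NE7FlatHkCurlLetter
import Summits.QuantumFields.BalabanUV.T4Continuum.Support.NE7SliceGreenDecayRows
import HarnessLib

/-!
# NE7FlatLiftSplitRow — (R7♭)-loc IN THE FORM THE TORUS ROAD v2 NEEDS: the flat Landau lift `R_H(B₁ + B₂)` of a SPLIT datum has fine curl bounded by the COARSE CURL
# of `B₁` (gen 65's LIN-ONE-STEP, (R7♭) GLOBAL) PLUS an exponentially WEIGHTED SIZE row of `B₂` (the decaying derivative kernel of lit-balaban's `H_k`,
# [Balaban1984PropagatorsII] Cor. 2.8 as gen 65's `norm_fdiff_HkOp_le_weighted`); for `B₂` supported at torus block-distance `≥ ℓ` from the block of the point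
# the size row is `≤ C·e^{−κ′ℓ∕2}·sup‖B₂‖`

Cell `pub-balaban`, rung (B)+1 sub-cell t4, lineage `b2b-balaban-t4-ne7-p1` (CRUX PROVER NE7 #1 = OWNER of row NE7), generation 89; memo
`t4/b2b-balaban-t4-ne7-p1-g89/COSTING-N1.md` §1, §5 (2).  File F256 (over F37 `NE7FlatHkCurlLetter` (the T4 ↔ torus curl dictionary, `norm_curlAt_flat_hkRightInverse_le`'s
chain), gen 65's `NE7LinOneStepAbelian.norm_curl_HkOp_le_curl ∕ norm_fdiff_HkOp_le_weighted ∕ Fs_eq_fdiff_sub`, F253a `NE7SliceGreenDecayRows` (torus block-distance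
bookkeeping), lit-balaban's `B5Hk163TorusHolderRate.sum_exp_torusSupNorm_sub_rep_le`).

WHY (memo §1: the shell part of the coarse-curl bound `ĝ`).  In the torus road the normal datum of the cut-off chart is `D_1(χ·A_loc) = χ̄·D_1A_loc + E`, `E` the
averaging commutator, supported on the shell's coarse bonds, of size `≍ osc(χ)·M·α₀` and of coarse curl `≍ osc(χ)·M²·α₁` — with a print-quality chart (`α₁ ≍ C′(R)(r+β)∕M²`,
`C′(R) ∝ R`) the GLOBAL (R7♭) applied to the whole datum leaves `C′(R)(r+β)∕R` undiscounted.  Splitting the datum: `χ̄·D_1A_loc` has coarse curl `≲ β_c + quadratic` (no `α₁`)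
and goes through (R7♭) GLOBAL; `E` is FAR from the plaquette and goes through the SIZE row with the exponentially decaying derivative kernel — no cone gauge (whose torus
holonomy terms are global) is needed.  THIS FILE is that split row, torus side and T4 side.
WHAT ([folklore] composition; 0 def, 0 sorry; dimension `d + 1`).
§1 `norm_Fs_HkOp_le_weighted` (plaquette field of `H_kB` by the weighted size row), **`norm_curlAt_flat_hkRightInverse_le_split`** (F37 §3 for `B = B₁ + B₂`:
   `‖curlAt 1 (R_H B)(z)‖ ≤ card n·[(C_LIN∕n)·f + (2C_dec∕n)·Σ_y e^{−κ′|blk z − y|_T}(d+1)w(y)]`).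
§2 **`rightInverse_flat_curl_le_split`** — T4-native: datum `φ = φ₁ + E` (`N`-periodic coarse T4 fields), `‖curlAt 1 φ₁‖ ≤ ĝ`, `‖E(rep y, λ)‖ ≤ W(y)`: the brick-2 right inverse
   of `M⁻¹·φ` is EXACT and `‖curlAt 1 (R_H(M⁻¹φ))(z)‖ ≤ card n·[(C_LIN∕M)(ĝ∕M) + (2(d+1)C_dec∕M)·Σ_y e^{−κ′|blk z − y|_T}·W(y)∕M]`.
§3 `sum_exp_far_weight_le` (far-supported weights: `Σ_y e^{−κ′D(y)}W(y) ≤ s·K(κ′∕2)·e^{−κ′ℓ∕2}`).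
HONEST FRAMING (page 1): a composition of tree theorems at `U = 1`; nothing printed is asserted ([B5] (1.63), [B6] (2.151) are TEXT LOCATIONS); NOT (APE), NOT ONE-STEP,
NOT NE7; spine 0∕9; finite T⁴ rung (B)+1 — NOT infinite volume, NOT mass gap, NOT `BetaPertH`, NOT Clay.  Continuum YM on T⁴ ⇐ BetaPertH ∧ nine spine estimates (0/9
proved); BetaPertH ⇐ (D1) ∧ (D4) ∧ CAP+tail; G-an2-4 gates asym, D1 and NE2/3/4.
-/

set_option autoImplicit false

open scoped BigOperators Matrix Matrix.Norms.L2Operator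
open Finset

namespace Summit.QuantumFields.BalabanUV.T4Continuum.NE7FlatLiftSplitRow

open Literature.MathematicalPhysics.QuantumFieldTheory.Balaban1983to89
open B7Prop1Explicit (Site e e_apply)
open T4AveragingDeficitWall (curlAt)
open AveragingDeficitPeriodicCounting (IsPeriodicDir)
open B4Sect5Proof (latticeConst latticeConst_nonneg)
open B4TorusKernel.MultiPeriod (torusSupNorm torusSupNorm_nonneg)
open B5Prop11Plancherel (Tor fine)
open B5Action121 (Fs Fs_apply)
open B5Blocks16 (blockOf)
open B5Hk163Strip (kappa163 kappa163_pos)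
open B5Hk163Torus (HkOp)
open B5Hk163TorusHolderDecay (CdecD CdecD_nonneg)
open B5Hk163TorusHolderRate (sum_exp_torusSupNorm_sub_rep_le)
open B6LowerBound2153Torus (toT rep toT_add)
open B6Cov2156Torus (one_le_M)
open BlockAveragePushDirSplit (flat)
open SmoothRefineInterp (interp)
open NE3TangentNoGoWords (dPot)
open NE3TangentFlatStructure (framePot)
open NE3SmoothLiftCurl (curlAt_flat_eq)
open NE3SmoothRightInverseCurl (curlAt_flat_dPot curlAt_flat_add)
open NE7LinOneStepAbelian (norm_curl_HkOp_le_curl norm_fdiff_HkOp_le_weighted Fs_eq_fdiff_sub)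
open NE7FlatHkCurlLetter (curlAt_flat_pullback_entry Fs_one_eq opNorm_le_card_mul apply_rep_toT apply_rep_add_unitVec)
open AveragingKernelRows (torusSupNorm_rep_sub_comm)
open Literature.Computability.QuantumComplexity.SolovayKitaev (norm_apply_le_norm)

noncomputable section

variable {d : ℕ} {n : Type*} [Fintype n] [DecidableEq n]

/-! ## §1 The split row on the torus: coarse curl of `B₁` + weighted size of `B₂` -/

section Torus

variable (nn : ℕ) [NeZero nn] (M : Fin (d + 1) → ℕ) [∀ μ, NeZero (M μ)]

/-- **THE PLAQUETTE FIELD OF `H_kB` BY THE WEIGHTED SIZE ROW**: `|F^η_{μν}(H_kB)(x)| ≤ 2·C_dec·Σ_y e^{−κ′|blk x − y|_T}·(d+1)·w(y)` whenever `|B(y,λ)| ≤ w(y)`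
(gen 65's `norm_fdiff_HkOp_le_weighted` on both derivative terms of `F = ∇_μ(·)_ν − ∇_ν(·)_μ`). [folklore] -/
theorem norm_Fs_HkOp_le_weighted (B : Tor M × Fin (d + 1) → ℂ) (w : Tor M → ℝ) (hB : ∀ y lam, ‖B (y, lam)‖ ≤ w y)
    (x : Tor (fine nn M)) (μ ν : Fin (d + 1)) :
    ‖Fs (fine nn M) (nn : ℂ) (HkOp nn M *ᵥ B) μ ν x‖
      ≤ 2 * (CdecD d * ∑ y : Tor M,
          Real.exp (-(kappa163 (d + 1) / (d + 1) * torusSupNorm M (rep M (blockOf nn M x) - rep M y))) * (((d : ℝ) + 1) * w y)) := by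
  rw [Fs_eq_fdiff_sub]
  have h1 := norm_fdiff_HkOp_le_weighted nn M B w hB x ν μ
  have h2 := norm_fdiff_HkOp_le_weighted nn M B w hB x μ ν
  calc _ ≤ ‖(B5Prop11Plancherel.fdiff (fine nn M) (nn : ℂ) μ *ᵥ (HkOp nn M *ᵥ B)) (x, ν)‖
          + ‖(B5Prop11Plancherel.fdiff (fine nn M) (nn : ℂ) ν *ᵥ (HkOp nn M *ᵥ B)) (x, μ)‖ := norm_sub_le _ _
    _ ≤ _ := by linarith

/-- **THE SPLIT ROW FOR THE T4 LIFT, TORUS DATA** (F37 §3 for `B = B₁ + B₂`): with `f` bounding the coarse curls of the entries of `B₁` and `w(y)` the entries of `B₂(y,·)`,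
`‖curlAt 1 (R_H B)(z)‖ ≤ card n·[(C_LIN∕n)·f + n⁻¹·2C_dec·Σ_y e^{−κ′|blk(z̄) − y|_T}(d+1)w(y)]` (`n = L^{j+1}`) — the corrector is curl-free, each entry of the flat curl
of the pull-back is `n⁻¹F^η` of `H_k` of that entry, `H_k` and `F` are additive. [folklore] -/
theorem norm_curlAt_flat_hkRightInverse_le_split [Nonempty n] (L j : ℕ) [NeZero (L ^ (j + 1))]
    (B B₁ B₂ : Tor M × Fin (d + 1) → Matrix n n ℂ) (hsplit : B = B₁ + B₂) {f : ℝ}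
    (hF : ∀ (i i' : n) (y : Tor M) (μ ν : Fin (d + 1)), ‖Fs M 1 (fun p : Tor M × Fin (d + 1) => B₁ p i i') μ ν y‖ ≤ f)
    (w : Tor M → ℝ) (hw : ∀ (i i' : n) (y : Tor M) (lam : Fin (d + 1)), ‖B₂ (y, lam) i i'‖ ≤ w y)
    (z : Site (d + 1)) (μ ν : Fin (d + 1)) :
    ‖curlAt (flat (d := d + 1) (n := n))
        ((fun (x : Site (d + 1)) (κ : Fin (d + 1)) => Matrix.of fun i i' : n =>
            (HkOp (L ^ (j + 1)) M *ᵥ fun p : Tor M × Fin (d + 1) => B p i i') (toT (fine (L ^ (j + 1)) M) x, κ))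
          + dPot (interp (L ^ (j + 1)) Finset.univ (framePot L (j + 1)
              (fun (x : Site (d + 1)) (κ : Fin (d + 1)) => Matrix.of fun i i' : n =>
                (HkOp (L ^ (j + 1)) M *ᵥ fun p : Tor M × Fin (d + 1) => B p i i') (toT (fine (L ^ (j + 1)) M) x, κ)))))
        z μ ν‖
      ≤ Fintype.card n * ((2 * (CdecD d * (((d : ℝ) + 1) * (2 * ((d : ℝ) + 1))
            * ((2 + 32 / (kappa163 (d + 1) / (d + 1)) ^ 2) * latticeConst (d + 1) (kappa163 (d + 1) / (d + 1) / 2)))))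
            / ((L ^ (j + 1) : ℕ) : ℝ) * f
          + (((L ^ (j + 1) : ℕ) : ℝ))⁻¹ * (2 * (CdecD d * ∑ y : Tor M,
              Real.exp (-(kappa163 (d + 1) / (d + 1) * torusSupNorm M (rep M (blockOf (L ^ (j + 1)) M (toT (fine (L ^ (j + 1)) M) z)) - rep M y)))
                * (((d : ℝ) + 1) * w y)))) := by
  set C : ℝ := 2 * (CdecD d * (((d : ℝ) + 1) * (2 * ((d : ℝ) + 1))
          * ((2 + 32 / (kappa163 (d + 1) / (d + 1)) ^ 2) * latticeConst (d + 1) (kappa163 (d + 1) / (d + 1) / 2)))) with hC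
  -- the corrector is curl-free
  rw [curlAt_flat_add, curlAt_flat_dPot, add_zero]
  refine opNorm_le_card_mul _ fun i i' => ?_
  -- entry (i,i') of the flat curl of the pull-back is `Fs (fine) 1 (H_k B_{ii'})` at `toT z`
  rw [curlAt_flat_pullback_entry (fine (L ^ (j + 1)) M) (fun i i' => HkOp (L ^ (j + 1)) M *ᵥ fun p : Tor M × Fin (d + 1) => B p i i') z μ ν i i']
  have hn0 : ((L ^ (j + 1) : ℕ) : ℂ) ≠ 0 := by exact_mod_cast (NeZero.ne (L ^ (j + 1)))
  have hnpos : (0 : ℝ) < ((L ^ (j + 1) : ℕ) : ℝ) := by exact_mod_cast Nat.pos_of_ne_zero (NeZero.ne (L ^ (j + 1)))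
  rw [Fs_one_eq (fine (L ^ (j + 1)) M) hn0, norm_mul, norm_inv, Complex.norm_natCast]
  -- the entry field splits, and so does `H_k` of it and its plaquette field
  have hentry : (fun p : Tor M × Fin (d + 1) => B p i i')
      = (fun p : Tor M × Fin (d + 1) => B₁ p i i') + (fun p : Tor M × Fin (d + 1) => B₂ p i i') := by
    funext p; rw [hsplit]; rfl
  have hH : HkOp (L ^ (j + 1)) M *ᵥ (fun p : Tor M × Fin (d + 1) => B p i i')
      = HkOp (L ^ (j + 1)) M *ᵥ (fun p : Tor M × Fin (d + 1) => B₁ p i i') + HkOp (L ^ (j + 1)) M *ᵥ (fun p : Tor M × Fin (d + 1) => B₂ p i i') := by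
    rw [hentry, Matrix.mulVec_add]
  rw [hH, Beta.Ineq167Operator.Fs_add]
  have h65 := norm_curl_HkOp_le_curl (L ^ (j + 1)) M (fun p : Tor M × Fin (d + 1) => B₁ p i i') (fun y μ' ν' => hF i i' y μ' ν')
    (toT (fine (L ^ (j + 1)) M) z) μ ν
  rw [← hC] at h65
  have hwt := norm_Fs_HkOp_le_weighted (L ^ (j + 1)) M (fun p : Tor M × Fin (d + 1) => B₂ p i i') w (fun y lam => hw i i' y lam)
    (toT (fine (L ^ (j + 1)) M) z) μ ν
  calc (((L ^ (j + 1) : ℕ) : ℝ))⁻¹ * ‖Fs (fine (L ^ (j + 1)) M) ((L ^ (j + 1) : ℕ) : ℂ) (HkOp (L ^ (j + 1)) M *ᵥ fun p : Tor M × Fin (d + 1) => B₁ p i i') μ ν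
            (toT (fine (L ^ (j + 1)) M) z)
          + Fs (fine (L ^ (j + 1)) M) ((L ^ (j + 1) : ℕ) : ℂ) (HkOp (L ^ (j + 1)) M *ᵥ fun p : Tor M × Fin (d + 1) => B₂ p i i') μ ν
            (toT (fine (L ^ (j + 1)) M) z)‖
      ≤ (((L ^ (j + 1) : ℕ) : ℝ))⁻¹ * (C * f + 2 * (CdecD d * ∑ y : Tor M,
          Real.exp (-(kappa163 (d + 1) / (d + 1) * torusSupNorm M (rep M (blockOf (L ^ (j + 1)) M (toT (fine (L ^ (j + 1)) M) z)) - rep M y)))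
            * (((d : ℝ) + 1) * w y))) :=
        mul_le_mul_of_nonneg_left ((norm_add_le _ _).trans (add_le_add h65 hwt)) (by positivity)
    _ = _ := by rw [div_eq_mul_inv]; ring

end Torus

/-! ## §2 The T4-native split row: datum `φ = φ₁ + E`, coarse curl of `φ₁` + weighted size of `E` -/

/-- **THE SPLIT (R7♭) ROW, T4-NATIVE** (cubic coarse torus of period `P`, `M = L^{j+1}`): for `P`-periodic coarse T4 fields `φ = φ₁ + E` with `‖curlAt 1 φ₁ y μ ν‖ ≤ ĝ`
everywhere and `‖E(rep y, λ)‖ ≤ W(y)` on the torus representatives, the brick-2 right inverse `R_H(M⁻¹·φ)` is EXACT (`cpushIter L j 1 (R_H(M⁻¹φ)) = φ`) and at EVERY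
fine point `‖curlAt 1 (R_H(M⁻¹φ))(z)‖ ≤ card n·[(C_LIN∕M)(ĝ∕M) + M⁻¹·2C_dec·Σ_y e^{−κ′|blk z̄ − y|_T}(d+1)(W(y)∕M)]`. [folklore] -/
theorem rightInverse_flat_curl_le_split [Nonempty n] {L : ℕ} (hL : 1 ≤ L) (j : ℕ) (P : ℕ) [NeZero P] [NeZero (L ^ (j + 1))]
    (φ φ₁ E : Site (d + 1) → Fin (d + 1) → Matrix n n ℂ) (hφ : φ = φ₁ + E)
    (hφP : AveragingDeficitPeriodicCounting.IsPeriodicDir φ (P : ℤ)) (hφ₁P : AveragingDeficitPeriodicCounting.IsPeriodicDir φ₁ (P : ℤ))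
    {g : ℝ} (hg : ∀ (y : Site (d + 1)) (μ ν : Fin (d + 1)), ‖curlAt (flat (d := d + 1) (n := n)) φ₁ y μ ν‖ ≤ g)
    (W : Tor (fun _ : Fin (d + 1) => P) → ℝ)
    (hW : ∀ (y : Tor (fun _ : Fin (d + 1) => P)) (lam : Fin (d + 1)), ‖E (B6LowerBound2153Torus.rep (fun _ : Fin (d + 1) => P) y) lam‖ ≤ W y) :
    ReplicationRightInverse.cpushIter L j (flat (d := d + 1) (n := n))
        ((fun (x : Site (d + 1)) (κ : Fin (d + 1)) => Matrix.of fun i i' : n =>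
      (HkOp (L ^ (j + 1)) (fun _ : Fin (d + 1) => P) *ᵥ fun p : Tor (fun _ : Fin (d + 1) => P) × Fin (d + 1) => (fun p : Tor (fun _ : Fin (d + 1) => P) × Fin (d + 1) => (((L ^ (j + 1) : ℕ) : ℂ))⁻¹ • φ (B6LowerBound2153Torus.rep (fun _ : Fin (d + 1) => P) p.1) p.2) p i i') (toT (fine (L ^ (j + 1)) (fun _ : Fin (d + 1) => P)) x, κ))
          + dPot (interp (L ^ (j + 1)) Finset.univ (framePot L (j + 1)
            (fun (x : Site (d + 1)) (κ : Fin (d + 1)) => Matrix.of fun i i' : n =>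
      (HkOp (L ^ (j + 1)) (fun _ : Fin (d + 1) => P) *ᵥ fun p : Tor (fun _ : Fin (d + 1) => P) × Fin (d + 1) => (fun p : Tor (fun _ : Fin (d + 1) => P) × Fin (d + 1) => (((L ^ (j + 1) : ℕ) : ℂ))⁻¹ • φ (B6LowerBound2153Torus.rep (fun _ : Fin (d + 1) => P) p.1) p.2) p i i') (toT (fine (L ^ (j + 1)) (fun _ : Fin (d + 1) => P)) x, κ))))) = φ ∧
      ∀ (z : Site (d + 1)) (μ ν : Fin (d + 1)),
        ‖curlAt (flat (d := d + 1) (n := n))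
            ((fun (x : Site (d + 1)) (κ : Fin (d + 1)) => Matrix.of fun i i' : n =>
      (HkOp (L ^ (j + 1)) (fun _ : Fin (d + 1) => P) *ᵥ fun p : Tor (fun _ : Fin (d + 1) => P) × Fin (d + 1) => (fun p : Tor (fun _ : Fin (d + 1) => P) × Fin (d + 1) => (((L ^ (j + 1) : ℕ) : ℂ))⁻¹ • φ (B6LowerBound2153Torus.rep (fun _ : Fin (d + 1) => P) p.1) p.2) p i i') (toT (fine (L ^ (j + 1)) (fun _ : Fin (d + 1) => P)) x, κ))
              + dPot (interp (L ^ (j + 1)) Finset.univ (framePot L (j + 1)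
                (fun (x : Site (d + 1)) (κ : Fin (d + 1)) => Matrix.of fun i i' : n =>
      (HkOp (L ^ (j + 1)) (fun _ : Fin (d + 1) => P) *ᵥ fun p : Tor (fun _ : Fin (d + 1) => P) × Fin (d + 1) => (fun p : Tor (fun _ : Fin (d + 1) => P) × Fin (d + 1) => (((L ^ (j + 1) : ℕ) : ℂ))⁻¹ • φ (B6LowerBound2153Torus.rep (fun _ : Fin (d + 1) => P) p.1) p.2) p i i') (toT (fine (L ^ (j + 1)) (fun _ : Fin (d + 1) => P)) x, κ))))) z μ ν‖
          ≤ Fintype.card n * ((2 * (CdecD d * (((d : ℝ) + 1) * (2 * ((d : ℝ) + 1))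
              * ((2 + 32 / (kappa163 (d + 1) / (d + 1)) ^ 2) * latticeConst (d + 1) (kappa163 (d + 1) / (d + 1) / 2)))))
              / ((L ^ (j + 1) : ℕ) : ℝ) * (g / ((L ^ (j + 1) : ℕ) : ℝ))
            + (((L ^ (j + 1) : ℕ) : ℝ))⁻¹ * (2 * (CdecD d * ∑ y : Tor (fun _ : Fin (d + 1) => P),
                Real.exp (-(kappa163 (d + 1) / (d + 1) * torusSupNorm (fun _ : Fin (d + 1) => P)
                  (B6LowerBound2153Torus.rep (fun _ : Fin (d + 1) => P) (blockOf (L ^ (j + 1)) (fun _ : Fin (d + 1) => P) (toT (fine (L ^ (j + 1)) (fun _ : Fin (d + 1) => P)) z))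
                    - B6LowerBound2153Torus.rep (fun _ : Fin (d + 1) => P) y)))
                  * (((d : ℝ) + 1) * (W y / ((L ^ (j + 1) : ℕ) : ℝ)))))) := by
  have hn0 : ((L ^ (j + 1) : ℕ) : ℂ) ≠ 0 := by exact_mod_cast (NeZero.ne (L ^ (j + 1)))
  have hnpos : (0 : ℝ) < ((L ^ (j + 1) : ℕ) : ℝ) := by exact_mod_cast Nat.pos_of_ne_zero (NeZero.ne (L ^ (j + 1)))
  refine ⟨?_, fun z μ ν => ?_⟩
  · -- (a) exactness: F36 + periodicity
    rw [NE7FlatHkRightInverse.cpushIter_flat_hkPull hL j (fun _ : Fin (d + 1) => P) (fun p : Tor (fun _ : Fin (d + 1) => P) × Fin (d + 1) => (((L ^ (j + 1) : ℕ) : ℂ))⁻¹ • φ (B6LowerBound2153Torus.rep (fun _ : Fin (d + 1) => P) p.1) p.2)]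
    funext z κ
    show (((L ^ (j + 1) : ℕ) : ℂ)) • ((((L ^ (j + 1) : ℕ) : ℂ))⁻¹ • φ (B6LowerBound2153Torus.rep (fun _ : Fin (d + 1) => P) (toT (fun _ : Fin (d + 1) => P) z)) κ) = φ z κ
    rw [smul_smul, mul_inv_cancel₀ hn0, one_smul, apply_rep_toT hφP]
  · -- (b) the split row of §1 with `B₁ := M⁻¹·φ₁∘rep`, `B₂ := M⁻¹·E∘rep`
    refine norm_curlAt_flat_hkRightInverse_le_split (fun _ : Fin (d + 1) => P) L j
      (fun p : Tor (fun _ : Fin (d + 1) => P) × Fin (d + 1) => (((L ^ (j + 1) : ℕ) : ℂ))⁻¹ • φ (B6LowerBound2153Torus.rep (fun _ : Fin (d + 1) => P) p.1) p.2)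
      (fun p : Tor (fun _ : Fin (d + 1) => P) × Fin (d + 1) => (((L ^ (j + 1) : ℕ) : ℂ))⁻¹ • φ₁ (B6LowerBound2153Torus.rep (fun _ : Fin (d + 1) => P) p.1) p.2)
      (fun p : Tor (fun _ : Fin (d + 1) => P) × Fin (d + 1) => (((L ^ (j + 1) : ℕ) : ℂ))⁻¹ • E (B6LowerBound2153Torus.rep (fun _ : Fin (d + 1) => P) p.1) p.2)
      ?_ (f := g / ((L ^ (j + 1) : ℕ) : ℝ)) (fun i i' y μ' ν' => ?_) (fun y => W y / ((L ^ (j + 1) : ℕ) : ℝ)) (fun i i' y lam => ?_) z μ ν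
    · funext p
      simp only [Pi.add_apply, hφ, smul_add]
    · have hFs : Fs (fun _ : Fin (d + 1) => P) 1 (fun p : Tor (fun _ : Fin (d + 1) => P) × Fin (d + 1) => (fun p : Tor (fun _ : Fin (d + 1) => P) × Fin (d + 1) => (((L ^ (j + 1) : ℕ) : ℂ))⁻¹ • φ₁ (B6LowerBound2153Torus.rep (fun _ : Fin (d + 1) => P) p.1) p.2) p i i') μ' ν' y
          = (((L ^ (j + 1) : ℕ) : ℂ))⁻¹ * curlAt (flat (d := d + 1) (n := n)) φ₁ (B6LowerBound2153Torus.rep (fun _ : Fin (d + 1) => P) y) μ' ν' i i' := by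
        rw [Fs_apply, curlAt_flat_eq, one_mul]
        simp only [Matrix.smul_apply, smul_eq_mul, Matrix.sub_apply]
        rw [apply_rep_add_unitVec hφ₁P y μ' ν', apply_rep_add_unitVec hφ₁P y ν' μ']
        ring
      rw [hFs, norm_mul, norm_inv, Complex.norm_natCast]
      have h1 := norm_apply_le_norm (curlAt (flat (d := d + 1) (n := n)) φ₁ (B6LowerBound2153Torus.rep (fun _ : Fin (d + 1) => P) y) μ' ν') i i'
      have h2 := hg (B6LowerBound2153Torus.rep (fun _ : Fin (d + 1) => P) y) μ' ν'
      rw [div_eq_inv_mul]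
      exact mul_le_mul_of_nonneg_left (h1.trans h2) (by positivity)
    · show ‖((((L ^ (j + 1) : ℕ) : ℂ))⁻¹ • E (B6LowerBound2153Torus.rep (fun _ : Fin (d + 1) => P) y) lam) i i'‖ ≤ W y / ((L ^ (j + 1) : ℕ) : ℝ)
      rw [Matrix.smul_apply, smul_eq_mul, norm_mul, norm_inv, Complex.norm_natCast, div_eq_inv_mul]
      exact mul_le_mul_of_nonneg_left ((norm_apply_le_norm _ i i').trans (hW y lam)) (by positivity)

/-! ## §3 Far-supported weights under the decaying row -/

/-- **FAR WEIGHTS ARE DISCOUNTED**: if `W ≤ s` everywhere and `W(y) ≤ 0` unless the block `y` is at torus block-distance `≥ ℓ` from `y₀`, then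
`Σ_y e^{−κ′|y₀ − y|_T}·W(y) ≤ s·K_{d+1}(κ′∕2)·e^{−κ′ℓ∕2}` (`κ′ = κ_{163}(d+1)∕(d+1)`). [folklore] -/
theorem sum_exp_far_weight_le (M : Fin (d + 1) → ℕ) [∀ μ, NeZero (M μ)] (y₀ : Tor M) (W : Tor M → ℝ) {s ℓ : ℝ} (hs : 0 ≤ s)
    (hWs : ∀ y, W y ≤ s) (hWnear : ∀ y, torusSupNorm M (rep M y - rep M y₀) < ℓ → W y ≤ 0) :
    ∑ y : Tor M, Real.exp (-(kappa163 (d + 1) / (d + 1) * torusSupNorm M (rep M y₀ - rep M y))) * W y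
      ≤ s * latticeConst (d + 1) (kappa163 (d + 1) / (d + 1) / 2) * Real.exp (-(kappa163 (d + 1) / (d + 1) / 2 * ℓ)) := by
  set κ' := kappa163 (d + 1) / (d + 1) with hκ'
  have hκ : 0 < κ' := div_pos (kappa163_pos (d + 1)) (by positivity)
  have hκ2 : 0 < κ' / 2 := by linarith
  have hterm : ∀ y : Tor M, Real.exp (-(κ' * torusSupNorm M (rep M y₀ - rep M y))) * W y
      ≤ s * Real.exp (-(κ' / 2 * ℓ)) * Real.exp (-(κ' / 2 * torusSupNorm M (rep M y₀ - rep M y))) := by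
    intro y
    have hD0 := torusSupNorm_nonneg (one_le_M M) (rep M y₀ - rep M y)
    by_cases hfar : ℓ ≤ torusSupNorm M (rep M y - rep M y₀)
    · rw [torusSupNorm_rep_sub_comm M y y₀] at hfar
      have hsplit : Real.exp (-(κ' * torusSupNorm M (rep M y₀ - rep M y)))
          ≤ Real.exp (-(κ' / 2 * ℓ)) * Real.exp (-(κ' / 2 * torusSupNorm M (rep M y₀ - rep M y))) := by
        rw [← Real.exp_add]
        exact Real.exp_le_exp.mpr (by nlinarith)
      calc Real.exp (-(κ' * torusSupNorm M (rep M y₀ - rep M y))) * W y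
          ≤ Real.exp (-(κ' * torusSupNorm M (rep M y₀ - rep M y))) * s := mul_le_mul_of_nonneg_left (hWs y) (Real.exp_pos _).le
        _ ≤ (Real.exp (-(κ' / 2 * ℓ)) * Real.exp (-(κ' / 2 * torusSupNorm M (rep M y₀ - rep M y)))) * s := mul_le_mul_of_nonneg_right hsplit hs
        _ = _ := by ring
    · have hW0 := hWnear y (lt_of_not_ge hfar)
      calc Real.exp (-(κ' * torusSupNorm M (rep M y₀ - rep M y))) * W y ≤ 0 :=
            mul_nonpos_of_nonneg_of_nonpos (Real.exp_pos _).le hW0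
        _ ≤ _ := by positivity
  have hsum := sum_exp_torusSupNorm_sub_rep_le M hκ2 (rep M y₀)
  calc ∑ y : Tor M, Real.exp (-(κ' * torusSupNorm M (rep M y₀ - rep M y))) * W y
      ≤ ∑ y : Tor M, s * Real.exp (-(κ' / 2 * ℓ)) * Real.exp (-(κ' / 2 * torusSupNorm M (rep M y₀ - rep M y))) := Finset.sum_le_sum fun y _ => hterm y
    _ = s * Real.exp (-(κ' / 2 * ℓ)) * ∑ y : Tor M, Real.exp (-(κ' / 2 * torusSupNorm M (rep M y₀ - rep M y))) := by rw [Finset.mul_sum]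
    _ ≤ s * Real.exp (-(κ' / 2 * ℓ)) * latticeConst (d + 1) (κ' / 2) := mul_le_mul_of_nonneg_left hsum (by positivity)
    _ = _ := by ring

end

end Summit.QuantumFields.BalabanUV.T4Continuum.NE7FlatLiftSplitRow
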